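import Summits.PneNP.PneNP.Theses.PhaseTwins
import Literature.Computability.Complexity.HardcoreInapproximability
import Literature.Computability.Cryptography.PseudorandomGeneratorsAnyOWF
import Literature.Computability.Cryptography.PRGStretchExtensionReduction
import Literature.Computability.Cryptography.GGM

/-!
# Line `prg-port-amplification` for crux `PhaseTwins.PseudorandomTwinsAbove` (stmt-PneNP-2721)

Skeleton (crux-plan, planner-cruxplan-stmt-PneNP-2721-prg-port-amplificati-0, 2026-08-16) of the crux idea
`prg-port-amplification` (crux-ideate r1 ideator 1; triage r1-1/2/3: pass, merged lever L2 with
`prg-image-exact-threshold-lift`), with the three triage sharpenings built in: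
(F3/B4) the gadget stub carries the printed WHP form of Sly's Theorem 2.1 TOGETHER WITH free-energy
concentration (a deterministic window `|log Z_G − L(n)| ≤ n_g^{θ/4}`, Sly 2010 Thm 3.10 / MWW09 in
substance), because the transport threshold depends on the sampled gadget through `Z_{Ĥ^G} = Z_G^N`;
(B6) typed clause (i) is derived from standard `IsCompIndistinguishable` only for FIXED-LENGTH graph-code
ensembles (`Monotone V` in `stub_assembly`); (F1) the line is CONDITIONAL: its one non-lemma input is the
conjecture `OWFExist` (`@[conjecture]`, Minicrypt), taken as the named hypothesis of
`PseudorandomTwinsAbove_of` — no stub disguises it. Every closing hypothesis of every r1 idea implies the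
summit (triage F1); this skeleton therefore yields `OWFExist → PseudorandomTwinsAbove`, the transport theorem
being the unconditional payload.

THE LINE. `OWFExist` ⟹ (HILL, PROVED `PRGExist_of_OWFExist`; Goldreich §3.3.1–3.3.2, PROVED
`IsPRG.isPRG_takeSucc`, `exists_isPRG_of_stretch_succ_holds`) a PRG `G` of stretch `2n+1`, so the string twins
`G(U_n)` vs `U_{2n+1}` are samplable, computationally indistinguishable, and `U_{2n+1}` misses `Im G` except with
probability `2^{-n-1}` ⟹ (`stub_karpChain`: sign/shape-uniform Cook–Levin → NAE-3SAT → MAX-CUT → simple-graph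
blow-up; `(N, e, K)` depend on `n` alone) exact-threshold MAX-CUT instances `H_y` on `Fin (Nv n)` with `ne n` edges,
`maxCut H_y ≥ K n` iff `y ∈ G({0,1}^n)` ⟹ (`stub_gadgetSampler`: Sly's random bipartite phase gadget at some
`(Δ, λ = p/q > λ_c(Δ))`, sampled with fresh coins `r` at size `n_g = ng n = poly(n)`, ports `V⁺ = [0,m)`,
`V⁻ = [m,2m)` by convention; WHP `(GpropA)`, `(GpropB)` AND the window) ⟹ (`stub_liftFP`: the map
`(1ⁿ, r ++ y) ↦ code(H_y^{G_r})`, `H^G = gadgetSubst` with `κ = m / N` parallel port edges per edge of `H`, is in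
`FP`) ⟹ (`stub_windowTransport` = Sly's Lemma 2.2 / proof of Thm 1 with the threshold made EXPLICIT and
G-INDEPENDENT inside the window: `T = (3/2)·C_e·B^{κK}/B^{κ}·e^{N(L+n^{θ/4})}`, YES ⇒ `Z(H^G) ≥ 8T`,
NO ⇒ `Z(H^G) ≤ T`, because the port gain `B^{κ}`, `κ ≥ n^{3θ/4} − 1`, beats phase entropy `n^{n^{θ/4}}` times the
window slack `e^{2N n^{θ/4}}`, `N ≤ n^{θ/4}/(d−1)`) ⟹ (`stub_assembly`: generic PPT/PMF transport — the two
push-forward ensembles are exactly samplable, index-fed negligible indistinguishability by the PROVED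
`IsCompIndistinguishable.sampled_append` + `.map_fp`, typed clause (i) by fixed-length simulation, clause (ii)
with `t n = ⌊T n⌋₊` by a union bound) the crux at `(Δ, p, q)`.

Stubs (5): `stub_karpChain` (M–L), `stub_gadgetSampler` (XL — literature strength: Sly 2010 Thm 2.1 in its
printed "with high probability" form, arXiv:1005.5584 p.8, + Thm 3.10 p.15 small-graph-conditioning
concentration, GGŠVY Lemma 5 for `d = 3`; NOT a lead-prover target, to be vendored as a named fact and
discharged bottom-up with `HardcoreInapproximabilityProofs`), `stub_windowTransport` (M, the card's First
lemma `threshold_transport` sharpened), `stub_liftFP` (M, encoding plumbing), `stub_assembly` (M–L, hardest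
provable-now stub). Composition `PseudorandomTwinsAbove_of (hOWF : OWFExist)` is kernel-checked with no `sorry`
of its own.

Disproof.lean (cdisprove cycle 1) honoured: `pseudorandomTwinsAbove_false_without_polyTime` — the time bound on
the tests is used exactly once, inside `stub_assembly`, where a typed test composed with the FP lift becomes a
PPT distinguisher for the PRG; `pseudorandomTwinsAboveWithoutPositivity_holds` — no junk: both ensembles live on
valid max-degree-`Δ` codes (`hshape`), so `0 < N` holds surely; `tv_lower_bound` respected (the twins ARE
statistically far); `isPolyTime_coinLen_irrelevant` is what makes the fixed-length simulation of clause (i)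
possible (B6). Negatives index (PneNP: 0265, 0988, 10247, 2493, 2222): none restated; no landed
`Theorems/PseudorandomTwinsAbove/Negative/*` lemma exists at planning time.
-/

noncomputable section

open scoped Classical BigOperators

namespace Summit.PneNP.PneNP.Cruxes.PseudorandomTwinsAbove.PrgPortAmplification

open Filter Topology
open _root_.Computability (unaryEncodeNat encodeBool)
open Literature.Computability.Complexity
open Literature.Computability.Cryptography
open Literature.Probability.LatticeModels (independencePolynomial hardCoreThreshold hardCoreThreshold_pos
  independencePolynomial_pos)
open Summit.PneNP.PneNP.Theses.PhaseTwins (PseudorandomTwinsAbove)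

set_option linter.unusedVariables false
set_option linter.dupNamespace false

/-! ## The stubs -/

/-- **S1 — sign/shape-uniform Karp chain to exact-threshold simple MAX-CUT (`SignUniformKarpChain`).**
For a polynomial-time, length-regular map `G` (`|G s| = 2|s| + 1`; here the PRG) there are a polynomial-time
map `fH`, shape functions `Nv` (strictly increasing, polynomially bounded), `ne`, and thresholds `K` such that
for every `y` of length `2n+1`, `fH y` is the code of a simple graph `H_y` on `Fin (Nv n)` with exactly `ne n`
edges, and `maxCut H_y ≥ K n` if `y ∈ G({0,1}^n)`, `maxCut H_y < K n` otherwise. Why true: the language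
`{y | ∃ s, |s| = (|y|-1)/2 ∧ G s = y}` is in `NP` (verifier runs `G`); Cook–Levin with the instance `y` entering
only as the SIGNS of unit/output literals of a fixed circuit `C_n` (tree: `CookLevin*.lean`), then NAE-4SAT →
NAE-3SAT → MAX-CUT (Garey–Johnson–Stockmeyer 1976 clause triangles + variable bundles: counts independent of
signs; tree: `MaxCutGadget*.lean`, `KarpMaxCutComplete.lean` for the weighted form) → weight-`w` edges replaced
by `w` paths of length `3` (`+2` per unit uncut, `+3` cut) to reach a SIMPLE graph; pad with isolated vertices /
disjoint fixed gadgets so that `(Nv, ne, K)` depend on `n` only and `Nv` is strictly increasing. Size M–L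
(machine work in the style of `MaxCutGadgetMachine.lean`). Why it might fail: only through a bookkeeping slip in
sign-uniformity, repaired by padding with sign-independent dummy clauses (card, cheapest falsifier (1)). -/
theorem stub_karpChain (G : List Bool → List Bool) (hG : G ∈ FP)
    (hlen : ∀ s : List Bool, (G s).length = 2 * s.length + 1) :
    ∃ (fH : List Bool → List Bool) (Nv ne K : ℕ → ℕ) (PN : Polynomial ℕ),
      fH ∈ FP ∧ StrictMono Nv ∧ (∀ n, Nv n ≤ PN.eval n) ∧
      ∀ (n : ℕ) (y : List Bool), y.length = 2 * n + 1 →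
        ∃ H : SimpleGraph (Fin (Nv n)),
          fH y = encodingGraph.encode ⟨Nv n, H⟩ ∧ H.edgeFinset.card = ne n ∧
          ((∃ s : List Bool, s.length = n ∧ G s = y) → K n ≤ maxCut H) ∧
          ((¬ ∃ s : List Bool, s.length = n ∧ G s = y) → maxCut H < K n) := by
  sorry

/-- **S2 — the samplable phase gadget with a free-energy window (stub S2 of the triage, option (a)/F3;
LITERATURE STRENGTH, XL).** At SOME `Δ ≥ 3` and rational `λ = p/q > λ_c(Δ)` (intended: `Δ = d = 3`, `λ = 5 > 4`,
where Sly's Condition 1.2 holds for all `λ > λ_c(3)`, GGŠVY Lemma 5 / §2.4) there are Sly's constants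
`θ ∈ (0, 1/8)`, `0 < q⁻ < q⁺ < 1` such that for every polynomial copy demand `PN` a polynomial-time map `SZ`
(the gadget sampler run on coins `r`, `|r| = a(n)`, at gadget size `n_g = ng n = poly(n)`, `ng` strictly
increasing with `PN(n) ≤ n_g^{θ/4}/(Δ-1)`) ALWAYS outputs `⟨1^m, code(G)⟩` for a graph `G` on
`Fin (m + (m + w))` of maximum degree `≤ Δ` whose conventional ports `V⁺ = castAdd [0,m)`, `V⁻ = natAdd m [0,m)`
have degree `≤ Δ - 1`, with `m = m(n) ≥ n_g^θ/(Δ-1)` (Sly: `m = (d-1)^{⌊θ log_{d-1} n_g⌋}`) and vertex count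
monotone in `n`; and WITH PROBABILITY `→ 1` over `r` the gadget satisfies `(GpropA)` at `n_g`, `(GpropB)` with
`δ = n_g^{-2θ}` (Sly 2010 Thm 2.1 = GŠV16 Lemma 19, "with high probability" over `G(n_g, θ, ψ)`,
arXiv:1005.5584 p.8) for SOME phase sets `W±`, AND `|log Z_G(λ) − Lz(n)| ≤ n_g^{θ/4}` for a deterministic `Lz`
(small-graph conditioning: Sly 2010 Thm 3.10, p.15, `P(Z^±_{G̃}(η) < n^{-1/2} E Z^±_{G̃}(η)) → 0` uniformly in
the boundary `η`, + Markov for the upper tail ⇒ `log Z_G = log E Z_G ± O(log n_g)` whp; MWW09 Lemma 7.6).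
The tree vendors only the derandomised ∃-form `slyGadgetReduction`; this is its sampler form plus
concentration — the trust base of every samplable Sly lift (L2, L3 of the triage). Exact samplability of the
configuration model needs a dyadic (TV-`2^{-n}`) Fisher–Yates with a deterministic fallback of the right shape,
absorbed in "probability `→ 1`". NOT a lead-prover target: vendor as a named fact with these cites and
discharge bottom-up (`HardcoreInapproximabilityProofs.lean` programme). Why it might fail: only if the window
needed `o(log n_g)` — it does not (`n_g^{θ/4}` slack). -/
theorem stub_gadgetSampler :
    ∃ (Δ p q : ℕ), 3 ≤ Δ ∧ 0 < q ∧ hardCoreThreshold Δ < (p : ℝ) / q ∧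
    ∃ (θ qp qm : ℝ), 0 < θ ∧ θ < 1 / 8 ∧ 0 < qm ∧ qm < qp ∧ qp < 1 ∧
    ∀ PN : Polynomial ℕ,
      ∃ (SZ : List Bool → List Bool) (a : Polynomial ℕ) (ng m w : ℕ → ℕ) (Lz : ℕ → ℝ),
        SZ ∈ FP ∧ StrictMono ng ∧ Monotone (fun n => m n + (m n + w n)) ∧
        (∀ n : ℕ, ((PN.eval n : ℕ) : ℝ) ≤ (ng n : ℝ) ^ (θ / 4) / ((Δ : ℝ) - 1)) ∧
        (∀ n : ℕ, (ng n : ℝ) ^ θ / ((Δ : ℝ) - 1) ≤ m n) ∧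
        (∀ (n : ℕ) (r : List Bool), r.length = a.eval n →
          ∃ G : SimpleGraph (Fin (m n + (m n + w n))),
            SZ (boolPair (unaryEncodeNat n) r) =
                boolPair (unaryEncodeNat (m n)) (encodingGraph.encode ⟨m n + (m n + w n), G⟩) ∧
              G.maxDegree ≤ Δ ∧
              (∀ i, G.degree (Fin.castAddEmb (m n + w n) i) ≤ Δ - 1) ∧
              (∀ i, G.degree (((Fin.castAddEmb (w n)).trans (Fin.natAddEmb (m n))) i) ≤ Δ - 1)) ∧
        ∀ ε : ℝ, 0 < ε → ∃ n₀ : ℕ, ∀ n : ℕ, n₀ ≤ n →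
          1 - ε ≤ uniformProb (a.eval n) {r | ∀ G : SimpleGraph (Fin (m n + (m n + w n))),
            SZ (boolPair (unaryEncodeNat n) r) =
                boolPair (unaryEncodeNat (m n)) (encodingGraph.encode ⟨m n + (m n + w n), G⟩) →
              ∃ Wp Wm : Finset (Fin (m n + (m n + w n))),
                SlyPropA G ((p : ℝ) / q) Wp Wm (ng n) ∧
                SlyPropB G ((p : ℝ) / q) Wp Wm (Fin.castAddEmb (m n + w n))
                  ((Fin.castAddEmb (w n)).trans (Fin.natAddEmb (m n))) qp qm ((ng n : ℝ) ^ (-(2 * θ))) ∧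
                |Real.log (independencePolynomial G ((p : ℝ) / q)) - Lz n| ≤ (ng n : ℝ) ^ (θ / 4)} := by
  sorry

/-- **S3 — window transport: a gadget-independent threshold (the card's First lemma `threshold_transport`,
sharpened by triage B4/F3; Sly 2010 Lemma 2.2 and proof of Thm 1).** For Sly constants `θ ∈ (0,1/8)`,
`0 < q⁻ < q⁺ < 1`, `λ ≥ 0`, `d ≥ 3` and all large `n`: ANY gadget satisfying the conclusions of Lemma 2.2 with
relative error `1/2` (`SlyCutEstimate`, supplied by the PROVED `slyCutEstimate_of_slyProps` from `(GpropA)`,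
`(GpropB)`) at `1 ≤ N ≤ n^{θ/4}/(d-1)` copies, `m ≥ n^θ/(d-1)` ports and `κ = m / N` parallel port edges per
edge, whose free energy lies in the window `|log Z_G − L| ≤ n^{θ/4}`, separates every graph `H` on `Fin N` by
ONE threshold `T = (3/2)·C_H·B^{κK}/B^{κ}·exp(N(L + n^{θ/4}))` (`C_H = slyC q⁺ q⁻ κ |E(H)|` depends on `H` only
through `|E(H)|`, `B = slyB q⁺ q⁻ > 1`): `maxCut H ≥ K ⇒ Z(H^G) ≥ 8T`, `maxCut H < K ⇒ Z(H^G) ≤ T`. Why true: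
exactly the proof of `slyGadgetReduction.twins` with `T` exposed — NO case: `Z(H^G) = Σ_Y Z(Y) ≤
(3/2) C B^{κ maxCut} Z_G^N ≤ T` (`independencePolynomial_gadgetSubst_bot`, window); YES case: at a maximum cut
`Z(H^G) ≥ (1/2) C B^{κK} n^{-n^{θ/4}} Z_G^N ≥ (1/2) C B^{κK} n^{-n^{θ/4}} e^{N(L − n^{θ/4})}`, and
`B^{κ} ≥ 24 n^{n^{θ/4}} e^{2N n^{θ/4}}` for large `n` since `κ ≥ n^{3θ/4} − 1` while
`N n^{θ/4} ≤ n^{θ/2}/(d-1)` (cf. `eventually_mul_rpow_rpow_le_slyB_pow`). Size M. Why it might fail: it cannot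
in substance (finite combinatorics + asymptotic arithmetic); the content is that the threshold is uniform over
the window, which is what makes a DETERMINISTIC `t(n)` possible with a fresh gadget per sample. -/
theorem stub_windowTransport {θ qp qm lam : ℝ} (hθ : 0 < θ) (hθ8 : θ < 1 / 8) (hqm : 0 < qm)
    (hlt : qm < qp) (hqp : qp < 1) (hlam : 0 ≤ lam) {d : ℕ} (hd : 3 ≤ d) :
    ∃ n₀ : ℕ, ∀ n : ℕ, n₀ ≤ n →
      ∀ {W : Type} [Fintype W] [DecidableEq W] (G : SimpleGraph W) (Wp Wm : Finset W) {m : ℕ}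
        (Vp Vm : Fin m ↪ W) (N : ℕ), 1 ≤ N → (N : ℝ) ≤ (n : ℝ) ^ (θ / 4) / ((d : ℝ) - 1) →
        (n : ℝ) ^ θ / ((d : ℝ) - 1) ≤ m →
        SlyCutEstimate G lam Wp Wm Vp Vm qp qm (1 / 2) n θ N (m / N) →
        ∀ L : ℝ, |Real.log (independencePolynomial G lam) - L| ≤ (n : ℝ) ^ (θ / 4) →
        ∀ (ι : Fin N × Fin (m / N) ↪ Fin m) (H : SimpleGraph (Fin N)) (K : ℕ),
          (K ≤ maxCut H →
            8 * (3 / 2 * slyC qp qm (m / N) H.edgeFinset.card *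
              (slyB qp qm ^ (m / N * K) / slyB qp qm ^ (m / N)) *
              Real.exp (N * (L + (n : ℝ) ^ (θ / 4)))) ≤
              independencePolynomial (gadgetSubst H G Vp Vm ι) lam) ∧
          (maxCut H < K →
            independencePolynomial (gadgetSubst H G Vp Vm ι) lam ≤
              3 / 2 * slyC qp qm (m / N) H.edgeFinset.card *
                (slyB qp qm ^ (m / N * K) / slyB qp qm ^ (m / N)) *
                Real.exp (N * (L + (n : ℝ) ^ (θ / 4)))) := by
  sorry

/-- **S4 — the lift is a polynomial-time string function (encoding plumbing).** For ANY polynomial-time `fH`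
(instance map) and `SZ` (gadget sampler as a function of `(1ⁿ, coins)`) and coin budget `a`, there is `F ∈ FP`
which on `⟨1ⁿ, r ++ y⟩` (`|r| = a(n)`) — whenever `fH y` is the code of `H` on `Fin N` and `SZ ⟨1ⁿ, r⟩ = ⟨1^m,
code(G)⟩` with `G` on `Fin (m + (m + w))` — outputs the code of Sly's substituted graph
`H^G = gadgetSubst H G V⁺ V⁻ ι` (ports by the convention `V⁺ = castAdd`, `V⁻ = natAdd m`, reservation
`ι = portReservation` with `κ = m / N`), transported to `Fin (N·(m+(m+w)))` along `finProdFinEquiv`. Why true: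
parse `1ⁿ`, split `r`/`y` by the computable `a(n)`, run `fH` and `SZ` (`PolyTimeComputable.comp_holds`), decode
the two adjacency matrices, write the `(N v)²` adjacency bits of `H^G` by the explicit rule `gadgetSubst_adj`
(row-major index arithmetic with `Plumb.divModFn`-style bricks, cf. `MaxCutGadgetMachine.lean`,
`SamplableMixtures.lean`). Size M (pure TM2/brick work, no mathematics). Why it might fail: it cannot; it is
filed as a stub because the composition `PseudorandomTwinsAbove_of` needs `F` as ONE `FP` function. -/
theorem stub_liftFP (fH : List Bool → List Bool) (hfH : fH ∈ FP) (SZ : List Bool → List Bool)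
    (hSZ : SZ ∈ FP) (a : Polynomial ℕ) :
    ∃ F : List Bool → List Bool, F ∈ FP ∧
      ∀ (n : ℕ) (r y : List Bool), r.length = a.eval n →
        ∀ (N : ℕ) (H : SimpleGraph (Fin N)) (m w : ℕ) (G : SimpleGraph (Fin (m + (m + w)))),
          fH y = encodingGraph.encode ⟨N, H⟩ →
          SZ (boolPair (unaryEncodeNat n) r) =
            boolPair (unaryEncodeNat m) (encodingGraph.encode ⟨m + (m + w), G⟩) →
          F (boolPair (unaryEncodeNat n) (r ++ y)) =
            encodingGraph.encode ⟨N * (m + (m + w)),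
              (gadgetSubst H G (Fin.castAddEmb (m + w)) ((Fin.castAddEmb w).trans (Fin.natAddEmb m))
                (portReservation (Nat.mul_div_le m N))).map finProdFinEquiv.toEmbedding⟩ := by
  sorry

/-- **S5 — generic assembly: PRG twins through a randomised shape-uniform FP lift give typed pseudorandom
twins (`TwinsFromPRG`; HARDEST provable-now stub).** Let `G` be a PRG of stretch `2n+1`, `F ∈ FP`, `a` a coin
budget, and suppose every `F⟨1ⁿ, r ++ y⟩` (`|r| = a(n)`, `|y| = 2n+1`) is the code of a max-degree-`≤ Δ` graph
on `Fin (V n)`, `V` monotone (FIXED code length per `n`), and that on a set `good n` of coin strings of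
probability `→ 1`, eventually, PRG images `y ∈ G({0,1}^n)` give `N(F…) ≥ 8 T(n)` and non-images give
`N(F…) ≤ T(n)`. Then the crux holds at `(Δ, p, q)` with `D₀ n = law of F⟨1ⁿ, r ++ G(s)⟩`, `D₁ n = law of
F⟨1ⁿ, r ++ u⟩` (`s ∼ U_n`, `u ∼ U_{2n+1}`, `r ∼ U_{a(n)}`), `t n = ⌊T n⌋₊`. Why true: (samplability) both laws
are output laws of PPT samplers on `1ⁿ` (coins `a(n) + n`, resp. `a(n) + 2n + 1`; `IsPRG.polyTimeComputable`,
FP composition as in `SamplableMixtures.lean`); (clause (i)) `G(U_n) ≈_c U_{2n+1}` (`IsPRG.isPseudorandom`) ⇒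
`r ++ y` twins (`IsCompIndistinguishable.sampled_append`, PROVED) ⇒ `F`-images (`.map_fp`, PROVED) ⇒ the TYPED
index-free `o(1)` clause by the fixed-length simulation of NegativeNotes B6 / card prg-image-exact-threshold-lift
(`D'(1ⁿ, x) := A(x)`, `coinLen_{D'}(2n+2+|x|) := coinLen_A(|x|)`, well defined because
`n ↦ 2n+2+codeLen(V n)` is injective for monotone `V`; `isPolyTime_coinLen_irrelevant`; negligible ⇒ `→ 0`) —
this is THE place where the tests' time bound is used (`pseudorandomTwinsAbove_false_without_polyTime`);
(clause (ii)) `D₀`: `Pr ≥ Pr[r ∈ good n] → 1` and `N ≥ 8T ≥ 8⌊T⌋₊`; `D₁`: `u ∉ G({0,1}^n)` except with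
probability `≤ 2^n/2^{2n+1}`, so `Pr ≥ (1-ε)(1 - 2^{-n-1}) → 1`, `N ≤ T ⇒ N ≤ ⌊T⌋₊`, and `0 < N` surely since
the code is valid of degree `≤ Δ` (`hardcoreCount_encode_eq_mul_independencePolynomial`, `Z ≥ 1`; this is the
junk-excluder of `pseudorandomTwinsAboveWithoutPositivity_holds`). Size M–L (RandAlg/PMF bookkeeping:
`uniformProb` ↔ `PMF.uniformOfFintype`, `Ensemble.prob` of bind/map, cylinder counts `cnt_drop`/`cnt_take`).
Why it might fail: it cannot in substance; the delicate point is the exact coin accounting of the fixed-length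
simulation, which is why `Monotone V` is a hypothesis. -/
theorem stub_assembly {Δ p q : ℕ} (hΔ : 3 ≤ Δ) (hq : 0 < q) (hlam : hardCoreThreshold Δ < (p : ℝ) / q)
    {G : List Bool → List Bool} (hG : IsPRG G (fun n => 2 * n + 1))
    {F : List Bool → List Bool} (hF : F ∈ FP) (a : Polynomial ℕ) {V : ℕ → ℕ} (hV : Monotone V)
    (hshape : ∀ (n : ℕ) (r y : List Bool), r.length = a.eval n → y.length = 2 * n + 1 →
      ∃ X : SimpleGraph (Fin (V n)),
        F (boolPair (unaryEncodeNat n) (r ++ y)) = encodingGraph.encode ⟨V n, X⟩ ∧ X.maxDegree ≤ Δ)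
    (good : ℕ → Set (List Bool)) (T : ℕ → ℝ)
    (hgood : ∀ ε : ℝ, 0 < ε → ∃ n₀ : ℕ, ∀ n : ℕ, n₀ ≤ n → 1 - ε ≤ uniformProb (a.eval n) (good n))
    (hgap : ∃ n₀ : ℕ, ∀ n : ℕ, n₀ ≤ n → ∀ r ∈ good n, r.length = a.eval n →
      ∀ y : List Bool, y.length = 2 * n + 1 →
        ((∃ s : List Bool, s.length = n ∧ G s = y) →
          8 * T n ≤ (hardcoreCount Δ p q (F (boolPair (unaryEncodeNat n) (r ++ y))) : ℝ)) ∧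
        ((¬ ∃ s : List Bool, s.length = n ∧ G s = y) →
          (hardcoreCount Δ p q (F (boolPair (unaryEncodeNat n) (r ++ y))) : ℝ) ≤ T n)) :
    ∃ D₀ D₁ : Literature.Computability.MetaComplexity.Ensemble,
      D₀.IsPolySamplable ∧ D₁.IsPolySamplable ∧
      (∀ A : RandAlg (List Bool) Bool, A.IsPolyTime (id : List Bool → List Bool) encodeBool →
        Tendsto (fun n : ℕ => |(∑' x : List Bool, ((D₀ n) x).toReal * A.pr id x {b | b = true}) -
          (∑' x : List Bool, ((D₁ n) x).toReal * A.pr id x {b | b = true})|) atTop (𝓝 0)) ∧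
      ∃ t : ℕ → ℕ,
        Tendsto (fun n : ℕ => D₀.prob n {x | 8 * t n ≤ hardcoreCount Δ p q x}) atTop (𝓝 1) ∧
        Tendsto (fun n : ℕ => D₁.prob n {x | 0 < hardcoreCount Δ p q x ∧ hardcoreCount Δ p q x ≤ t n})
          atTop (𝓝 1) := by
  sorry

/-! ## Proved glue -/

/-- The independence polynomial is invariant under transport along a bijection of the vertices. -/
theorem independencePolynomial_map_equiv {α β : Type*} [Fintype α] [DecidableEq α] [Fintype β]
    [DecidableEq β] (G : SimpleGraph α) [DecidableRel G.Adj] (e : α ≃ β) (lam : ℝ)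
    {i₁ : DecidableRel (G.map e.toEmbedding).Adj} :
    @independencePolynomial β _ _ (G.map e.toEmbedding) i₁ ℝ _ lam = independencePolynomial G lam := by
  have hadj : ∀ a b : α, (G.map e.toEmbedding).Adj (e.toEmbedding a) (e.toEmbedding b) ↔ G.Adj a b :=
    fun a b => SimpleGraph.map_adj_apply
  have hind : ∀ I : Finset α,
      (G.map e.toEmbedding).IsIndepSet (↑(I.map e.toEmbedding) : Set β) ↔ G.IsIndepSet (↑I : Set α) := by
    intro I
    constructor
    · intro h a ha b hb hab
      have hab' : e.toEmbedding a ≠ e.toEmbedding b := fun h' => hab (e.injective h')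
      have := h (Finset.mem_coe.2 (Finset.mem_map_of_mem _ (Finset.mem_coe.1 ha)))
        (Finset.mem_coe.2 (Finset.mem_map_of_mem _ (Finset.mem_coe.1 hb))) hab'
      exact fun hG => this ((hadj a b).2 hG)
    · intro h x hx y hy hxy
      obtain ⟨a, ha, rfl⟩ := Finset.mem_map.1 (Finset.mem_coe.1 hx)
      obtain ⟨b, hb, rfl⟩ := Finset.mem_map.1 (Finset.mem_coe.1 hy)
      exact fun hG => h (Finset.mem_coe.2 ha) (Finset.mem_coe.2 hb) (fun hab => hxy (by rw [hab]))
        ((hadj a b).1 hG)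
  unfold independencePolynomial
  symm
  refine Fintype.sum_equiv (Equiv.finsetCongr e) _ _ fun I => ?_
  rw [Equiv.finsetCongr_apply, Finset.card_map]
  by_cases hI : G.IsIndepSet (↑I : Set α)
  · rw [if_pos hI, if_pos ((hind I).2 hI)]
  · rw [if_neg hI, if_neg (fun h => hI ((hind I).1 h))]

/-- Transport of a degree bound along an isomorphism, for ANY decidability instances. -/
theorem maxDegree_le_of_iso {α β : Type*} [Fintype α] [Fintype β] {G : SimpleGraph α} {H : SimpleGraph β}
    {iG : DecidableRel G.Adj} {iH : DecidableRel H.Adj} (f : G ≃g H) {Δ : ℕ}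
    (h : @SimpleGraph.maxDegree α G _ iG ≤ Δ) : @SimpleGraph.maxDegree β H _ iH ≤ Δ := by
  have := f.maxDegree_eq
  rw [← this]; exact h

/-- The conventional port ranges `V⁺ = [0, m)` and `V⁻ = [m, 2m)` of a gadget on `Fin (m + (m + w))` are
disjoint. -/
theorem ports_disjoint (m w : ℕ) :
    Disjoint (Set.range (Fin.castAddEmb (m + w) : Fin m ↪ Fin (m + (m + w))))
      (Set.range ((Fin.castAddEmb w).trans (Fin.natAddEmb m) : Fin m ↪ Fin (m + (m + w)))) := by
  rw [Set.disjoint_left]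
  rintro x ⟨i, rfl⟩ ⟨j, hj⟩
  have h2 := congrArg Fin.val hj
  have hi := i.isLt
  simp [Fin.castAddEmb_apply, Function.Embedding.trans_apply] at h2
  omega

/-! ## The composition (kernel-checked, no `sorry` of its own) -/

/-- **`PseudorandomTwinsAbove` from the five stubs, CONDITIONALLY ON `OWFExist`.** The conjecture leaf is an
explicit named hypothesis (`@[conjecture] OWFExist`, Minicrypt), never a stub: by triage finding F1 every
closing hypothesis of this crux implies the summit, and this line's transport theorem is what is provable now.
Proof: HILL + stretch extension (PROVED in tree) give a PRG of stretch `2n+1`; S2 fixes `(Δ, p, q)` and Sly's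
constants; S1 the Karp chain with copy demand `PN`; S2 the gadget sampler for `PN`; S4 the lift `F`; the shape
hypothesis of S5 is S1 + S2 + S4 + `maxDegree_gadgetSubst_le`; the gap hypothesis on the good coins is
Lemma 2.2 (`slyCutEstimate_of_slyProps`, PROVED) + S3 at gadget size `ng n ≥ n` +
`hardcoreCount = q^{V} · Z` (`hardcoreCount_encode_eq_mul_independencePolynomial`); S5 concludes. -/
theorem PseudorandomTwinsAbove_of (hOWF : OWFExist) : PseudorandomTwinsAbove := by
  -- Step 0: a pseudorandom generator of stretch `2n + 1` (HILL; Goldreich §3.3.1–§3.3.2; all PROVED)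
  obtain ⟨G₀, ℓ₀, hG₀⟩ := PRGExist_of_OWFExist hOWF
  obtain ⟨G, hG⟩ := exists_isPRG_of_stretch_succ_holds ⟨_, hG₀.isPRG_takeSucc⟩ (fun n => 2 * n + 1)
    ⟨Polynomial.X + Polynomial.X + 1, fun n => by simp [two_mul]⟩ (fun n => by omega)
    GGM.polyTimeComputable_two_mul_add_one
  have hGfp : G ∈ FP := hG.polyTimeComputable
  have hGlen : ∀ s : List Bool, (G s).length = 2 * s.length + 1 := fun s => hG.length_eq s
  -- Step 1: Sly's constants and the activity `(Δ, p, q)` of the gadget stub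
  obtain ⟨Δ, p, q, hΔ, hq, hlam, θ, qp, qm, hθ, hθ8, hqm, hlt, hqp, hgad⟩ := stub_gadgetSampler
  have hlam0 : (0 : ℝ) ≤ (p : ℝ) / q := ((hardCoreThreshold_pos hΔ).trans hlam).le
  have hΔ1 : 1 ≤ Δ := by omega
  have hd1 : (1 : ℝ) ≤ (Δ : ℝ) - 1 := by
    have : (3 : ℝ) ≤ Δ := by exact_mod_cast hΔ
    linarith
  -- Step 2: the shape-uniform Karp chain for the image of `G`
  obtain ⟨fH, Nv, ne, K, PN, hfH, hNv, hPN, hkarp⟩ := stub_karpChain G hGfp hGlen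
  -- Step 3: the gadget sampler for copy demand `PN`
  obtain ⟨SZ, a, ng, m, w, Lz, hSZ, hng, hmono, hcap, hport, hshapeG, hgoodG⟩ := hgad PN
  -- Step 4: the lift `F ∈ FP`
  obtain ⟨F, hF, hlift⟩ := stub_liftFP fH hfH SZ hSZ a
  -- Step 5: Lemma 2.2 and the window transport, at gadget sizes `ng n ≥ n`
  obtain ⟨n₃, hn₃⟩ := stub_windowTransport (lam := (p : ℝ) / q) hθ hθ8 hqm hlt hqp hlam0 hΔ
  obtain ⟨n₄, hn₄⟩ := slyCutEstimate_of_slyProps (ε := 1 / 2) hθ (by norm_num) hqm hlt hqp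
  -- capacity: `Nv n ≤ PN n ≤ ng^{θ/4}/(Δ-1) ≤ ng^{θ/4}`
  have hcapd : ∀ n, (Nv n : ℝ) ≤ (ng n : ℝ) ^ (θ / 4) / ((Δ : ℝ) - 1) := fun n =>
    (show (Nv n : ℝ) ≤ ((PN.eval n : ℕ) : ℝ) by exact_mod_cast hPN n).trans (hcap n)
  have hcap' : ∀ n, (Nv n : ℝ) ≤ (ng n : ℝ) ^ (θ / 4) := fun n =>
    (hcapd n).trans (div_le_self (Real.rpow_nonneg (Nat.cast_nonneg _) _) hd1)
  -- the shape of every output, and its semantics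
  have hout : ∀ (n : ℕ) (r y : List Bool), r.length = a.eval n → y.length = 2 * n + 1 →
      ∃ (H : SimpleGraph (Fin (Nv n))) (Gg : SimpleGraph (Fin (m n + (m n + w n)))),
        fH y = encodingGraph.encode ⟨Nv n, H⟩ ∧ H.edgeFinset.card = ne n ∧
        ((∃ s : List Bool, s.length = n ∧ G s = y) → K n ≤ maxCut H) ∧
        ((¬ ∃ s : List Bool, s.length = n ∧ G s = y) → maxCut H < K n) ∧
        SZ (boolPair (unaryEncodeNat n) r) =
          boolPair (unaryEncodeNat (m n)) (encodingGraph.encode ⟨m n + (m n + w n), Gg⟩) ∧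
        Gg.maxDegree ≤ Δ ∧
        (∀ i, Gg.degree (Fin.castAddEmb (m n + w n) i) ≤ Δ - 1) ∧
        (∀ i, Gg.degree (((Fin.castAddEmb (w n)).trans (Fin.natAddEmb (m n))) i) ≤ Δ - 1) ∧
        F (boolPair (unaryEncodeNat n) (r ++ y)) =
          encodingGraph.encode ⟨Nv n * (m n + (m n + w n)),
            (gadgetSubst H Gg (Fin.castAddEmb (m n + w n))
              ((Fin.castAddEmb (w n)).trans (Fin.natAddEmb (m n)))
              (portReservation (Nat.mul_div_le (m n) (Nv n)))).map finProdFinEquiv.toEmbedding⟩ := by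
    intro n r y hr hy
    obtain ⟨H, hfy, hE, hyes, hno⟩ := hkarp n y hy
    obtain ⟨Gg, hSZr, hdegG, hdp, hdm⟩ := hshapeG n r hr
    exact ⟨H, Gg, hfy, hE, hyes, hno, hSZr, hdegG, hdp, hdm, hlift n r y hr (Nv n) H (m n) (w n) Gg hfy hSZr⟩
  -- degree of Sly's substituted graph (before transport to `Fin (N·v)`)
  have hdegSub : ∀ (n : ℕ) (H : SimpleGraph (Fin (Nv n))) (Gg : SimpleGraph (Fin (m n + (m n + w n)))),
      Gg.maxDegree ≤ Δ → (∀ i, Gg.degree (Fin.castAddEmb (m n + w n) i) ≤ Δ - 1) →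
      (∀ i, Gg.degree (((Fin.castAddEmb (w n)).trans (Fin.natAddEmb (m n))) i) ≤ Δ - 1) →
      (gadgetSubst H Gg (Fin.castAddEmb (m n + w n))
          ((Fin.castAddEmb (w n)).trans (Fin.natAddEmb (m n)))
          (portReservation (Nat.mul_div_le (m n) (Nv n)))).maxDegree ≤ Δ :=
    fun n H Gg hdegG hdp hdm => maxDegree_gadgetSubst_le H Gg (Fin.castAddEmb (m n + w n))
      ((Fin.castAddEmb (w n)).trans (Fin.natAddEmb (m n)))
      (portReservation (Nat.mul_div_le (m n) (Nv n))) hΔ1 hdegG (ports_disjoint (m n) (w n)) hdp hdm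
  -- Step 6: the generic assembly
  refine ⟨Δ, p, q, hΔ, hq, hlam, stub_assembly hΔ hq hlam hG hF a (V := fun n => Nv n * (m n + (m n + w n)))
    ?_ ?_ _ (fun n => (q : ℝ) ^ (Nv n * (m n + (m n + w n))) *
      (3 / 2 * slyC qp qm (m n / Nv n) (ne n) *
        (slyB qp qm ^ (m n / Nv n * K n) / slyB qp qm ^ (m n / Nv n)) *
        Real.exp (Nv n * (Lz n + (ng n : ℝ) ^ (θ / 4))))) hgoodG ?_⟩
  · -- `V` is monotone (fixed code length per `n`)
    intro i j hij
    exact Nat.mul_le_mul (hNv.monotone hij) (hmono hij)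
  · -- shape: every output is the code of a max-degree-`≤ Δ` graph on `Fin (V n)`
    intro n r y hr hy
    obtain ⟨H, Gg, hfy, hE, hyes, hno, hSZr, hdegG, hdp, hdm, hFeq⟩ := hout n r y hr hy
    exact ⟨_, hFeq, maxDegree_le_of_iso (SimpleGraph.Iso.map finProdFinEquiv _) (hdegSub n H Gg hdegG hdp hdm)⟩
  · -- gap on the good coins, eventually
    refine ⟨max (max n₃ n₄) 1, fun n hn r hr hrlen y hy => ?_⟩
    have hn3 : n₃ ≤ ng n := (le_of_max_le_left (le_of_max_le_left hn)).trans hng.le_apply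
    have hn4 : n₄ ≤ ng n := (le_of_max_le_right (le_of_max_le_left hn)).trans hng.le_apply
    have hN1 : 1 ≤ Nv n := (le_of_max_le_right hn).trans hNv.le_apply
    obtain ⟨H, Gg, hfy, hE, hyes, hno, hSZr, hdegG, hdp, hdm, hFeq⟩ := hout n r y hrlen hy
    simp only [Set.mem_setOf_eq] at hr
    obtain ⟨Wp, Wm, hA, hB, hwin⟩ := hr Gg hSZr
    -- Lemma 2.2 for this gadget (PROVED in the tree)
    have hcut : SlyCutEstimate Gg ((p : ℝ) / q) Wp Wm (Fin.castAddEmb (m n + w n))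
        ((Fin.castAddEmb (w n)).trans (Fin.natAddEmb (m n))) qp qm (1 / 2) (ng n) θ (Nv n) (m n / Nv n) :=
      hn₄ (ng n) hn4 Gg hlam0 Wp Wm _ _ hA hB (Nv n) (m n / Nv n) (hcap' n)
    -- the window transport
    obtain ⟨hyesZ, hnoZ⟩ := hn₃ (ng n) hn3 Gg Wp Wm (Fin.castAddEmb (m n + w n))
      ((Fin.castAddEmb (w n)).trans (Fin.natAddEmb (m n))) (Nv n) hN1 (hcapd n) (hport n) hcut (Lz n) hwin
      (portReservation (Nat.mul_div_le (m n) (Nv n))) H (K n)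
    -- `N(x) = q^{V} · Z(H^G)`
    have hcount : (hardcoreCount Δ p q (F (boolPair (unaryEncodeNat n) (r ++ y))) : ℝ) =
        (q : ℝ) ^ (Nv n * (m n + (m n + w n))) *
          independencePolynomial (gadgetSubst H Gg (Fin.castAddEmb (m n + w n))
            ((Fin.castAddEmb (w n)).trans (Fin.natAddEmb (m n)))
            (portReservation (Nat.mul_div_le (m n) (Nv n)))) ((p : ℝ) / q) := by
      rw [hFeq, hardcoreCount_encode_eq_mul_independencePolynomial Δ p q hq, independencePolynomial_map_equiv]
      exact maxDegree_le_of_iso (SimpleGraph.Iso.map finProdFinEquiv _) (hdegSub n H Gg hdegG hdp hdm)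
    have hqV : (0 : ℝ) ≤ (q : ℝ) ^ (Nv n * (m n + (m n + w n))) := pow_nonneg (Nat.cast_nonneg q) _
    rw [hE] at hyesZ hnoZ
    constructor
    · intro hs
      have h1 := mul_le_mul_of_nonneg_left (hyesZ (hyes hs)) hqV
      rw [hcount]
      linarith [h1]
    · intro hs
      have h1 := mul_le_mul_of_nonneg_left (hnoZ (hno hs)) hqV
      rw [hcount]
      linarith [h1]

end Summit.PneNP.PneNP.Cruxes.PseudorandomTwinsAbove.PrgPortAmplification
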